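import Mathlib
import Literature.NumberTheory.QuadraticFields.GaussianPrimary
import HarnessLib

/-!
# V. A. Lebesgue (1850): `x ^ p = y ^ 2 + 1` has no solution in non-zero integers

This is the case "`q = 2`" of Catalan's equation `x ^ p - y ^ q = 1`, the first of the four cases
into which the proof of Catalan's conjecture (`Literature.NumberTheory.DiophantineGeometry.mihailescu`,
abc.S19) splits [Schoof2009, Chapter 1]. We formalise the proof printed in R. Schoof, *Catalan's
Conjecture*, Universitext (2008), Proposition 2.1 (pp. 7–8), a 2-adic argument in the ring of
Gaussian integers `ℤ[i]`:

1. an even exponent is immediate (`(x ^ (p/2) - y)(x ^ (p/2) + y) = 1` forces `y = 0`), so let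
   `p` be odd; reducing modulo `4` shows `y` is even;
2. `w = 1 + i y` and `w̄ = 1 - i y` are coprime with product `x ^ p`, so by unique factorisation in
   `ℤ[i]` and because its four units are `p`-th powers (`p` odd), `w = c ^ p` for some
   `c = a + b i`;
3. `c + c̄ = 2a` divides `c ^ p + c̄ ^ p = 2`, so `a = ±1`, and comparing norms `b` is even; hence
   `Re (1 + b i) ^ p = ±1` for an even `b ≠ 0`;
4. (the 2-adic step) `Re (1 + b i) ^ p = 1 - C(p,2) b ² + C(p,4) b ⁴ - ⋯`; by the identity
   `j (2j-1) C(p,2j) = C(p,2) C(p-2,2j-2)` every term with `j ≥ 2` has strictly larger 2-adic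
   valuation than `C(p,2) b ²`, and all terms are divisible by `4`, which is incompatible with the
   value `±1`.

Main statement: `Catalan.lebesgue`. Everything here is proved; no named facts are introduced.
-/

namespace Literature.NumberTheory.DiophantineGeometry

namespace Catalan

open Finset Zsqrtd

/-! ### Step 4: the 2-adic size of the even binomial terms -/

/-- The binomial identity `C(p,2j) · j (2j-1) = C(p,2) · C(p-2,2j-2)` (`j ≥ 1`), i.e.
`C(p,2j) C(2j,2) = C(p,2) C(p-2,2j-2)` [Schoof2009, proof of Proposition 2.1].
[cite: Schoof2009, Proposition 2.1] -/
theorem choose_two_mul_mul (p j : ℕ) (hj : 1 ≤ j) :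
    p.choose (2 * j) * (j * (2 * j - 1)) = p.choose 2 * (p - 2).choose (2 * j - 2) := by
  have h := Nat.choose_mul (n := p) (k := 2 * j) (s := 2) (by omega)
  have h2 : (2 * j).choose 2 = j * (2 * j - 1) := by
    rw [Nat.choose_two_right, Nat.mul_assoc, Nat.mul_div_cancel_left _ (by norm_num)]
  rw [h2] at h
  exact h

/-- The 2-adic estimate of [Schoof2009, proof of Proposition 2.1]: for `b ≠ 0` even, `j ≥ 2` and
`2j ≤ p`, `ord₂ (C(p,2j) b^(2j)) > ord₂ (C(p,2) b²)`. [cite: Schoof2009, Proposition 2.1] -/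
theorem padicValNat_choose_two_lt {p j b : ℕ} (hj : 2 ≤ j) (hjp : 2 * j ≤ p) (hb : b ≠ 0)
    (hb2 : 2 ∣ b) :
    padicValNat 2 (p.choose 2 * b ^ 2) + 1 ≤ padicValNat 2 (p.choose (2 * j) * b ^ (2 * j)) := by
  have hC2 : p.choose 2 ≠ 0 := (Nat.choose_pos (by omega)).ne'
  have hC : p.choose (2 * j) ≠ 0 := (Nat.choose_pos hjp).ne'
  have hC' : (p - 2).choose (2 * j - 2) ≠ 0 := (Nat.choose_pos (by omega)).ne'
  have hj0 : j ≠ 0 := by omega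
  have hj1 : 2 * j - 1 ≠ 0 := by omega
  have hjo : ¬ 2 ∣ 2 * j - 1 := by omega
  have hv := congrArg (padicValNat 2) (choose_two_mul_mul p j (by omega))
  rw [padicValNat.mul hC (mul_ne_zero hj0 hj1), padicValNat.mul hj0 hj1,
    padicValNat.mul hC2 hC', padicValNat.eq_zero_of_not_dvd hjo] at hv
  have hvb : 1 ≤ padicValNat 2 b := one_le_padicValNat_of_dvd hb hb2
  have hvj : padicValNat 2 j ≤ j - 1 := by
    have h2 : 2 ^ padicValNat 2 j ≤ j := Nat.le_of_dvd (by omega) pow_padicValNat_dvd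
    have h3 : padicValNat 2 j < 2 ^ padicValNat 2 j := Nat.lt_two_pow_self
    omega
  rw [padicValNat.mul hC2 (pow_ne_zero _ hb), padicValNat.mul hC (pow_ne_zero _ hb),
    padicValNat.pow, padicValNat.pow]
  have hsplit : 2 * j * padicValNat 2 b = 2 * padicValNat 2 b + (2 * j - 2) * padicValNat 2 b := by
    rw [← Nat.add_mul]
    congr 1
    omega
  have hk : 2 * j - 2 ≤ (2 * j - 2) * padicValNat 2 b := Nat.le_mul_of_pos_right _ hvb
  omega

/-! ### Real parts of powers of `1 + b i` -/

/-- `Zsqrtd.re` commutes with finite sums. [folklore] -/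
theorem re_sum {α : Type*} (s : Finset α) (f : α → GaussianInt) :
    (∑ k ∈ s, f k).re = ∑ k ∈ s, (f k).re := by
  classical
  induction s using Finset.induction_on with
  | empty => simp
  | insert a s ha ih => rw [Finset.sum_insert ha, Finset.sum_insert ha, Zsqrtd.re_add, ih]

/-- `(b i) ² = -b ²` in `ℤ[i]`. [folklore] -/
theorem sqrtd_mul_sq (b : ℤ) :
    (sqrtd * (b : GaussianInt)) ^ 2 = ((-b ^ 2 : ℤ) : GaussianInt) := by
  ext <;> simp [pow_two]

/-- Real part of an even power of `b i`. [folklore] -/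
theorem re_sqrtd_mul_pow_even (b : ℤ) (j : ℕ) :
    ((sqrtd * (b : GaussianInt)) ^ (2 * j)).re = (-b ^ 2) ^ j := by
  rw [pow_mul, sqrtd_mul_sq, ← Int.cast_pow, Zsqrtd.re_intCast]

/-- Real part of an odd power of `b i` vanishes. [folklore] -/
theorem re_sqrtd_mul_pow_odd (b : ℤ) (j : ℕ) :
    ((sqrtd * (b : GaussianInt)) ^ (2 * j + 1)).re = 0 := by
  rw [pow_succ, pow_mul, sqrtd_mul_sq, ← Int.cast_pow, Zsqrtd.re_mul, Zsqrtd.re_intCast,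
    Zsqrtd.im_intCast]
  simp

/-- Binomial expansion of the real part: `Re (1 + b i)^p = ∑ₖ C(p,k) Re (b i)^k`. [folklore] -/
theorem re_one_add_pow (b : ℤ) (p : ℕ) :
    ((⟨1, b⟩ : GaussianInt) ^ p).re =
      ∑ k ∈ range (p + 1), (p.choose k : ℤ) * ((sqrtd * (b : GaussianInt)) ^ k).re := by
  have hw : (⟨1, b⟩ : GaussianInt) = sqrtd * (b : GaussianInt) + 1 := by ext <;> simp
  rw [hw, add_pow]
  simp only [one_pow, mul_one]
  rw [re_sum]
  refine Finset.sum_congr rfl fun k _ => ?_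
  rw [mul_comm, Zsqrtd.re_mul]
  simp

/-- The `0`-th term of the expansion of `Re (1 + b i)^p` is `1`. [folklore] -/
theorem term_zero (p : ℕ) (b : ℤ) :
    (p.choose 0 : ℤ) * ((sqrtd * (b : GaussianInt)) ^ 0).re = 1 := by simp

/-- The first term of the expansion of `Re (1 + b i)^p` vanishes. [folklore] -/
theorem term_one (p : ℕ) (b : ℤ) :
    (p.choose 1 : ℤ) * ((sqrtd * (b : GaussianInt)) ^ 1).re = 0 := by simp

/-- The second term of the expansion of `Re (1 + b i)^p` is `-C(p,2) b²`. [folklore] -/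
theorem term_two (p : ℕ) (b : ℤ) :
    (p.choose 2 : ℤ) * ((sqrtd * (b : GaussianInt)) ^ 2).re = -((p.choose 2 : ℤ) * b ^ 2) := by
  have h := re_sqrtd_mul_pow_even b 1
  simp only [mul_one, pow_one] at h
  rw [h]
  ring

/-- For an even `k = 2j`, the term is `± C(p,2j) |b|^(2j)`. [folklore] -/
theorem term_even (p : ℕ) (b : ℤ) (j : ℕ) :
    (p.choose (2 * j) : ℤ) * ((sqrtd * (b : GaussianInt)) ^ (2 * j)).re =
      (-1) ^ j * ((p.choose (2 * j) * b.natAbs ^ (2 * j) : ℕ) : ℤ) := by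
  rw [re_sqrtd_mul_pow_even]
  push_cast
  rw [pow_mul, sq_abs, neg_pow]
  ring

/-- Divisibility of the higher terms [Schoof2009, proof of Proposition 2.1]: for `3 ≤ k ≤ p` and
`b ≠ 0` even, both `2 ^ (ord₂ (C(p,2) b²) + 1)` and `4` divide the `k`-th term.
[cite: Schoof2009, Proposition 2.1] -/
theorem dvd_term_of_three_le {p : ℕ} {b : ℤ} (hb : b ≠ 0) (hb2 : 2 ∣ b) {k : ℕ}
    (hk3 : 3 ≤ k) (hkp : k ≤ p) :
    (2 : ℤ) ^ (padicValNat 2 (p.choose 2 * b.natAbs ^ 2) + 1) ∣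
        (p.choose k : ℤ) * ((sqrtd * (b : GaussianInt)) ^ k).re ∧
      (4 : ℤ) ∣ (p.choose k : ℤ) * ((sqrtd * (b : GaussianInt)) ^ k).re := by
  rcases Nat.even_or_odd k with ⟨j, hj⟩ | ⟨j, hj⟩
  · -- `k = 2 j`, `j ≥ 2`
    obtain rfl : k = 2 * j := by omega
    have hbn : b.natAbs ≠ 0 := Int.natAbs_ne_zero.2 hb
    have hbn2 : 2 ∣ b.natAbs := by
      have := Int.natAbs_dvd_natAbs.2 hb2
      simpa using this
    rw [term_even]
    constructor
    · refine Dvd.dvd.mul_left ?_ _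
      have h := padicValNat_choose_two_lt (p := p) (by omega) hkp hbn hbn2
      have hT : p.choose (2 * j) * b.natAbs ^ (2 * j) ≠ 0 :=
        mul_ne_zero (Nat.choose_pos hkp).ne' (pow_ne_zero _ hbn)
      have hd : 2 ^ (padicValNat 2 (p.choose 2 * b.natAbs ^ 2) + 1) ∣
          p.choose (2 * j) * b.natAbs ^ (2 * j) := (padicValNat_dvd_iff_le hT).2 h
      exact_mod_cast hd
    · refine Dvd.dvd.mul_left ?_ _
      have h4 : (4 : ℕ) ∣ b.natAbs ^ (2 * j) := by
        rw [show (4 : ℕ) = 2 ^ 2 by norm_num]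
        exact (pow_dvd_pow_of_dvd hbn2 2).trans (pow_dvd_pow _ (by omega))
      exact_mod_cast h4.mul_left (p.choose (2 * j))
  · -- `k` odd: the term vanishes
    obtain rfl : k = 2 * j + 1 := by omega
    simp only [re_sqrtd_mul_pow_odd, mul_zero, dvd_zero, and_self]

/-- **The 2-adic contradiction** [Schoof2009, proof of Proposition 2.1]: for `p ≥ 2` and an even
`b ≠ 0`, the real part of `(1 + b i) ^ p` is neither `1` nor `-1`.
[cite: Schoof2009, Proposition 2.1] -/
theorem re_one_add_pow_ne {p : ℕ} {b : ℤ} (hp : 2 ≤ p) (hb : b ≠ 0) (hb2 : 2 ∣ b) :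
    ((⟨1, b⟩ : GaussianInt) ^ p).re ≠ 1 ∧ ((⟨1, b⟩ : GaussianInt) ^ p).re ≠ -1 := by
  -- the terms of the binomial expansion of the real part
  set t : ℕ → ℤ := fun k => (p.choose k : ℤ) * ((sqrtd * (b : GaussianInt)) ^ k).re with ht
  -- split the expansion as `1 + 0 + t₂ + U`
  have hexp :
      ((⟨1, b⟩ : GaussianInt) ^ p).re = 1 + t 2 + ∑ k ∈ range (p - 2), t (k + 3) := by
    rw [re_one_add_pow]
    change ∑ k ∈ range (p + 1), t k = _
    obtain ⟨n, rfl⟩ : ∃ n, p = n + 2 := ⟨p - 2, by omega⟩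
    rw [show n + 2 + 1 = n + 3 from rfl, Finset.sum_range_succ', Finset.sum_range_succ',
      Finset.sum_range_succ']
    have h0 : t 0 = 1 := term_zero _ _
    have h1 : t (0 + 1) = 0 := term_one _ _
    rw [h0, h1]
    simp only [Nat.add_sub_cancel]
    ring
  set e := padicValNat 2 (p.choose 2 * b.natAbs ^ 2) with he
  set U := ∑ k ∈ range (p - 2), t (k + 3) with hU
  have hU2 : (2 : ℤ) ^ (e + 1) ∣ U ∧ (4 : ℤ) ∣ U := by
    refine ⟨Finset.dvd_sum fun k hk => ?_, Finset.dvd_sum fun k hk => ?_⟩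
    · have hk' : k < p - 2 := by simpa using hk
      exact (dvd_term_of_three_le hb hb2 (by omega) (by omega)).1
    · have hk' : k < p - 2 := by simpa using hk
      exact (dvd_term_of_three_le hb hb2 (by omega) (by omega)).2
  -- the second term: `4 ∣ t₂` but `2^(e+1) ∤ t₂`
  have hbn : b.natAbs ≠ 0 := Int.natAbs_ne_zero.2 hb
  have ht2' : t 2 = -((p.choose 2 : ℤ) * b ^ 2) := term_two _ _
  have ht2 : t 2 = -((p.choose 2 * b.natAbs ^ 2 : ℕ) : ℤ) := by
    rw [ht2']
    push_cast
    rw [sq_abs]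
  have ht2_4 : (4 : ℤ) ∣ t 2 := by
    rw [ht2', dvd_neg]
    refine Dvd.dvd.mul_left ?_ _
    rw [show (4 : ℤ) = 2 ^ 2 by norm_num]
    exact pow_dvd_pow_of_dvd hb2 2
  have ht2_not : ¬ (2 : ℤ) ^ (e + 1) ∣ t 2 := by
    rw [ht2, dvd_neg]
    intro h
    have h' : 2 ^ (e + 1) ∣ p.choose 2 * b.natAbs ^ 2 := by exact_mod_cast h
    exact pow_succ_padicValNat_not_dvd
      (mul_ne_zero (Nat.choose_pos hp).ne' (pow_ne_zero _ hbn)) h'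
  constructor
  · intro h1
    rw [hexp] at h1
    -- `t₂ = -U` is divisible by `2^(e+1)`
    have h2 : t 2 = -U := by linarith
    rw [h2, dvd_neg] at ht2_not
    exact ht2_not hU2.1
  · intro h1
    rw [hexp] at h1
    -- `t₂ + U = -2` would be divisible by `4`
    have h4 : (4 : ℤ) ∣ t 2 + U := dvd_add ht2_4 hU2.2
    rw [show t 2 + U = -2 by linarith] at h4
    norm_num at h4

/-! ### Steps 2–3: descent in `ℤ[i]` -/

/-- The four units `±1, ±i` of `ℤ[i]` (`GaussianPrimary.eq_of_isUnit`) have order dividing `4`.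
[folklore] -/
theorem units_pow_four_eq_one (u : GaussianIntˣ) : (u : GaussianInt) ^ 4 = 1 := by
  rcases QuadraticFields.GaussianPrimary.eq_of_isUnit u.isUnit with h | h | h | h <;>
    (rw [h]; decide)

/-- In `ℤ[i]` every unit is a `p`-th power when `p` is odd: `u = (u ^ p) ^ p`. [folklore] -/
theorem units_eq_pow_pow {p : ℕ} (hp : Odd p) (u : GaussianIntˣ) :
    (u : GaussianInt) = ((u : GaussianInt) ^ p) ^ p := by
  obtain ⟨r, rfl⟩ := hp
  rw [← pow_mul, show (2 * r + 1) * (2 * r + 1) = 4 * (r ^ 2 + r) + 1 by ring, pow_add, pow_mul,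
    units_pow_four_eq_one, one_pow, one_mul, pow_one]

/-- **Step 2** [Schoof2009, proof of Proposition 2.1]: if `p` is odd, `y` is even and
`x ^ p = y ^ 2 + 1`, then `1 + y i = c ^ p` for some Gaussian integer `c` (coprimality of
`1 ± y i`, unique factorisation in `ℤ[i]`, and its units being `p`-th powers).
[cite: Schoof2009, Proposition 2.1] -/
theorem exists_eq_pow_of_odd {x y : ℤ} {p : ℕ} (hp : Odd p) (hy : 2 ∣ y)
    (h : x ^ p = y ^ 2 + 1) : ∃ c : GaussianInt, c ^ p = ⟨1, y⟩ := by
  obtain ⟨s, rfl⟩ := hy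
  set w : GaussianInt := ⟨1, 2 * s⟩ with hw
  have hstar : star w = ⟨1, -(2 * s)⟩ := rfl
  -- coprimality by an explicit Bézout relation
  have hcop : IsCoprime w (star w) := by
    refine ⟨⟨1 - 2 * s ^ 2, -(2 * s)⟩, ⟨-(2 * s ^ 2), 0⟩, ?_⟩
    rw [hstar, hw]
    ext <;> simp <;> ring
  -- the product is a `p`-th power
  have hprod : w * star w = (x : GaussianInt) ^ p := by
    rw [← Int.cast_pow, h, Zsqrtd.intCast_val, hstar, hw]
    ext
    · simp
      ring
    · simp
  obtain ⟨d, u, hdu⟩ := exists_associated_pow_of_mul_eq_pow' hcop hprod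
  refine ⟨d * (u : GaussianInt) ^ p, ?_⟩
  rw [mul_pow, ← units_eq_pow_pow hp u, hdu]

/-- **Step 3** [Schoof2009, proof of Proposition 2.1]: if `c ^ p = 1 + y i` with `p` odd, then
`Re c = ±1` (because `c + c̄ = 2 Re c` divides `c ^ p + c̄ ^ p = 2`), and taking norms
`(Re c ² + Im c ²) ^ p = 1 + y ²`. [cite: Schoof2009, Proposition 2.1] -/
theorem re_eq_of_pow_eq {y : ℤ} {p : ℕ} (hp : Odd p) {c : GaussianInt}
    (hc : c ^ p = ⟨1, y⟩) :
    (c.re = 1 ∨ c.re = -1) ∧ (c.re ^ 2 + c.im ^ 2) ^ p = 1 + y ^ 2 := by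
  constructor
  · have hdvd : c + star c ∣ c ^ p + (star c) ^ p := Odd.add_dvd_pow_add_pow c (star c) hp
    rw [← star_pow, hc] at hdvd
    have h1 : c + star c = ((2 * c.re : ℤ) : GaussianInt) := by ext <;> simp [two_mul]
    have h2 : (⟨1, y⟩ : GaussianInt) + star ⟨1, y⟩ = ((2 * 1 : ℤ) : GaussianInt) := by
      ext <;> simp
    rw [h1, h2, Zsqrtd.intCast_dvd_intCast] at hdvd
    have h3 : c.re ∣ 1 := (mul_dvd_mul_iff_left (by norm_num : (2 : ℤ) ≠ 0)).1 hdvd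
    exact Int.isUnit_iff.1 (isUnit_of_dvd_one h3)
  · have hn := congrArg Zsqrtd.norm hc
    rw [QuadraticFields.GaussianPrimary.norm_pow', Zsqrtd.norm_def, Zsqrtd.norm_def] at hn
    simp only at hn
    have e1 : c.re * c.re - -1 * c.im * c.im = c.re ^ 2 + c.im ^ 2 := by ring
    rw [e1] at hn
    rw [hn]
    ring

/-! ### The theorem -/

/-- **V. A. Lebesgue (1850)** [Schoof2009, Proposition 2.1]: for any exponent `p ≥ 2` the
Diophantine equation `x ^ p = y ^ 2 + 1` has no solution in integers with `y ≠ 0` (a fortiori none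
in non-zero integers `x, y`, as printed). [cite: Schoof2009, Proposition 2.1] -/
theorem lebesgue {x y : ℤ} {p : ℕ} (hp : 2 ≤ p) (hy : y ≠ 0) : x ^ p ≠ y ^ 2 + 1 := by
  intro h
  rcases Nat.even_or_odd p with ⟨k, hk⟩ | hpo
  · -- even exponent: a difference of two squares equal to `1`
    have h1 : (x ^ k - y) * (x ^ k + y) = 1 := by
      have h0 : (x ^ k) ^ 2 = y ^ 2 + 1 := by rw [← pow_mul, show k * 2 = p by omega]; exact h
      linear_combination h0
    have h2 : x ^ k - y = x ^ k + y := Int.eq_of_mul_eq_one h1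
    exact hy (by linarith)
  · -- odd exponent `p ≥ 3`; first, `y` is even
    have hy2 : 2 ∣ y := by
      by_contra hyo
      have hyo' : Odd y := Int.not_even_iff_odd.1 (fun h2 => hyo (even_iff_two_dvd.1 h2))
      rcases Int.even_or_odd x with ⟨n, rfl⟩ | hxo
      · obtain ⟨m, rfl⟩ := hyo'
        have hsplit : (n + n) ^ p = (n + n) ^ 2 * (n + n) ^ (p - 2) := by
          rw [← pow_add]; congr 1; omega
        have h4 : (4 : ℤ) ∣ (n + n) ^ p := ⟨n ^ 2 * (n + n) ^ (p - 2), by rw [hsplit]; ring⟩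
        rw [h, show (2 * m + 1) ^ 2 + 1 = 4 * (m ^ 2 + m) + 2 by ring] at h4
        have h5 : (4 : ℤ) ∣ 2 := (dvd_add_right ⟨m ^ 2 + m, rfl⟩).1 h4
        omega
      · have h1 : Odd (x ^ p) := hxo.pow
        have h2 : Even (y ^ 2 + 1) := hyo'.pow.add_odd odd_one
        rw [← h] at h2
        exact (Int.not_even_iff_odd.2 h1) h2
    -- `1 + y i = c ^ p` with `Re c = ±1`
    obtain ⟨c, hc⟩ := exists_eq_pow_of_odd hpo hy2 h
    obtain ⟨hre, hnorm⟩ := re_eq_of_pow_eq hpo hc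
    obtain ⟨a, b⟩ := c
    dsimp only at hre hnorm
    have hre2 : a ^ 2 = 1 := by rcases hre with rfl | rfl <;> norm_num
    rw [hre2] at hnorm
    -- `b` is even: otherwise `(1 + b²)^p ≡ 0 (mod 4)` while `1 + y² ≡ 1 (mod 4)`
    have hb2 : 2 ∣ b := by
      by_contra hbo
      have hbo' : Odd b := Int.not_even_iff_odd.1 (fun h2 => hbo (even_iff_two_dvd.1 h2))
      obtain ⟨m, hm⟩ := hbo'
      obtain ⟨s, hs⟩ := hy2
      have hsplit : (1 + b ^ 2) ^ p = (1 + b ^ 2) ^ 2 * (1 + b ^ 2) ^ (p - 2) := by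
        rw [← pow_add]; congr 1; omega
      have h4 : (4 : ℤ) ∣ (1 + b ^ 2) ^ p := by
        rw [hsplit, hm]
        exact Dvd.dvd.mul_right ⟨(2 * m ^ 2 + 2 * m + 1) ^ 2, by ring⟩ _
      rw [hnorm, hs] at h4
      have h5 : (4 : ℤ) ∣ 1 := (dvd_add_left ⟨s ^ 2, by ring⟩).1 h4
      omega
    -- `b ≠ 0`, since `y ≠ 0`
    have hb0 : b ≠ 0 := by
      rintro rfl
      have e : (⟨a, 0⟩ : GaussianInt) = ((a : ℤ) : GaussianInt) := by ext <;> simp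
      have hi := congrArg Zsqrtd.im hc
      rw [e, ← Int.cast_pow, Zsqrtd.im_intCast] at hi
      exact hy (by simpa using hi.symm)
    -- reduce to `Re (1 + b i)^p = ±1`
    rcases hre with rfl | rfl
    · exact (re_one_add_pow_ne hp hb0 hb2).1 (by simpa using congrArg Zsqrtd.re hc)
    · have e : (⟨-1, b⟩ : GaussianInt) = -⟨1, -b⟩ := by ext <;> simp
      rw [e, Odd.neg_pow hpo] at hc
      have h3 := congrArg Zsqrtd.re hc
      simp only [Zsqrtd.re_neg] at h3
      exact (re_one_add_pow_ne hp (neg_ne_zero.2 hb0) (dvd_neg.2 hb2)).2 (by linarith)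

end Catalan

end Literature.NumberTheory.DiophantineGeometry
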